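import Summits.Ventures.PercRepro.C026HubB

/-!
# C-026 on hub graphs, III: the injections `Bot₃ ↪ ac|b ⊔ bc|a` (p5, gen 8)

The three maps of mine-3's proof (§17.10 (vi)), adapted to the cell's cut tree, each with an
explicit decoder (left inverse) that gives injectivity:

* **Case 1** (`phi1`): open the `a`-edge of a `c`-hub with edges to `a` and `b` — the image is in
  `ac|b` (`phi1_mem`); the opened edge is the unique open `a`-edge whose hub has an open `c`-edge
  (`phi1_open_a_iff`), so closing such edges decodes (`closeA`, `closeA_phi1`);
* **Case 2 with a `bc`-edge `e₀`**: open `e₀` — image in `bc|a` (`phi2_mem`), decoded by closing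
  `e₀` (`update_bc_inv`);
* **Case 2 without a `bc`-edge** (`phi3`): open the `c`- and `b`-edges of an isolated hub — image
  in `bc|a` (`phi3_mem`); the two opened edges are the only open `b`/`c`-edges of a hub with open
  edges to both (`phi3_open_iff`), so closing such edges decodes (`closeBC`, `closeBC_phi3`).
-/

namespace PercRepro

open Finset

namespace MultiGraph

variable {V E : Type*} {G : MultiGraph V E}

section Injection

open Classical

variable {a b c : V}

/-! #### Case 1: open the `a`-edge of a `c`-hub -/

variable (G)

/-- The `c`-hub chosen in Case 1. -/
noncomputable def case1Hub {ω : Config E} (h : G.Case1 ω a b c) : V := Classical.choose h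

/-- Its edge to `a`. -/
noncomputable def case1Edge {ω : Config E} (h : G.Case1 ω a b c) : E :=
  Classical.choose (Classical.choose_spec h).2.2.1

/-- **The Case-1 map**: open the `a`-edge of the chosen `c`-hub. -/
noncomputable def phi1 [DecidableEq E] (a b c : V) (ω : Config E) : Config E :=
  if h : G.Case1 ω a b c then Function.update ω (G.case1Edge h) true else ω

/-- **The Case-1 decoder**: close every open `a`-edge whose hub has an open `c`-edge. -/
noncomputable def closeA [DecidableEq E] (a b c : V) (ω₁ : Config E) : Config E := fun f =>
  if ω₁ f = true ∧ ∃ h, IsHubV a b c h ∧ G.Link f h a ∧ G.OpenTo ω₁ h c then false else ω₁ f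

variable {G}

/-- The chosen `c`-hub of Case 1 is a hub with an open `c`-edge, the chosen `a`-edge, and a `b`-edge. -/
theorem case1Hub_spec {ω : Config E} (h : G.Case1 ω a b c) :
    IsHubV a b c (G.case1Hub h) ∧ G.OpenTo ω (G.case1Hub h) c ∧
      G.Link (G.case1Edge h) (G.case1Hub h) a ∧ G.HasEdge (G.case1Hub h) b :=
  ⟨(Classical.choose_spec h).1, (Classical.choose_spec h).2.1,
    Classical.choose_spec (Classical.choose_spec h).2.2.1, (Classical.choose_spec h).2.2.2⟩

/-- In `bot`, the `a`-edge of a `c`-hub is closed. -/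
theorem IsBot.closed_of_openTo_c {ω : Config E} (hbot : G.IsBot ω a b c) (hac : a ≠ c)
    {h : V} (hc : G.OpenTo ω h c) {e : E} (hl : G.Link e h a) : ω e = false := by
  cases he : ω e
  · rfl
  · exact (hbot.openTo_unique (Or.inl rfl) (Or.inr (Or.inr rfl)) hac ⟨e, he, hl⟩ hc).elim

/-- The opened edge is the only open `a`-edge of a `c`-hub in the Case-1 image. -/
theorem phi1_open_a_iff [DecidableEq E] (hac : a ≠ c) {ω : Config E} (hbot : G.IsBot ω a b c)
    (h1 : G.Case1 ω a b c) (f : E) :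
    (Function.update ω (G.case1Edge h1) true f = true ∧
      ∃ h, IsHubV a b c h ∧ G.Link f h a ∧
        G.OpenTo (Function.update ω (G.case1Edge h1) true) h c) ↔
      f = G.case1Edge h1 := by
  obtain ⟨hh, hc, hl, -⟩ := case1Hub_spec h1
  have hne : ∀ (h : V) (g : E), IsHubV a b c h → G.Link g h c → g ≠ G.case1Edge h1 := by
    intro h g hh' hg hge
    subst hge
    rcases hl.ends_eq hg with ⟨-, h'⟩ | ⟨h', -⟩
    · exact hac h'.symm
    · exact hh'.1 h'
  constructor
  · rintro ⟨hf, h, hh', hlf, g, hg, hlg⟩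
    by_contra hfe
    rw [Function.update_of_ne hfe] at hf
    rw [Function.update_of_ne (hne h g hh' hlg)] at hg
    exact hbot.openTo_unique (Or.inl rfl) (Or.inr (Or.inr rfl)) hac ⟨f, hf, hlf⟩ ⟨g, hg, hlg⟩
  · rintro rfl
    refine ⟨Function.update_self .., G.case1Hub h1, hh, hl, ?_⟩
    obtain ⟨g, hg, hlg⟩ := hc
    exact ⟨g, by rw [Function.update_of_ne (hne _ g hh hlg)]; exact hg, hlg⟩

/-- The decoder inverts the Case-1 map on `bot ∩ Case 1`. -/
theorem closeA_phi1 [DecidableEq E] (hac : a ≠ c) {ω : Config E} (hbot : G.IsBot ω a b c)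
    (h1 : G.Case1 ω a b c) : G.closeA a b c (G.phi1 a b c ω) = ω := by
  obtain ⟨-, hc, hl, -⟩ := case1Hub_spec h1
  have h0 : ω (G.case1Edge h1) = false := hbot.closed_of_openTo_c hac hc hl
  funext f
  unfold phi1
  rw [dif_pos h1]
  unfold closeA
  by_cases hf : f = G.case1Edge h1
  · rw [if_pos ((G.phi1_open_a_iff hac hbot h1 f).2 hf), hf, h0]
  · rw [if_neg (fun h => hf ((G.phi1_open_a_iff hac hbot h1 f).1 h)), Function.update_of_ne hf]

/-- The Case-1 image lies in `ac|b`. -/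
theorem phi1_mem [DecidableEq E] (hG : G.IsHubGraph a b c) (hs : G.IsSimple) (hab : a ≠ b) (hac : a ≠ c)
    (hbc : b ≠ c) {ω : Config E} (hbot : G.IsBot ω a b c) (h1 : G.Case1 ω a b c) :
    G.Conn (G.phi1 a b c ω) a c ∧ ¬ G.Conn (G.phi1 a b c ω) a b := by
  obtain ⟨hh, hc, hl, -⟩ := case1Hub_spec h1
  unfold phi1
  rw [dif_pos h1]
  constructor
  · have h1' : G.Conn (Function.update ω (G.case1Edge h1) true) (G.case1Hub h1) a :=
      hl.conn (Function.update_self ..)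
    exact h1'.symm.trans hc.conn.update_true
  · refine hbot.not_conn_ab_of_ac_side hG hs hab hac hbc fun e he he0 => ?_
    have hee : e = G.case1Edge h1 := by
      by_contra hee
      rw [Function.update_of_ne hee] at he
      exact Bool.noConfusion (he0.symm.trans he)
    subst hee
    exact hl.boundary_iff (P := fun x => x = a ∨ x = c ∨ G.OpenTo ω x a ∨ G.OpenTo ω x c)
      ⟨fun _ => Or.inl rfl, fun _ => Or.inr (Or.inr (Or.inr hc))⟩

/-! #### Case 2 with a `bc`-edge: open it -/

/-- **The Case-2 map with a `bc`-edge `e₀`**: open `e₀`. -/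
theorem phi2_mem [DecidableEq E] (hG : G.IsHubGraph a b c) (hs : G.IsSimple) (hab : a ≠ b) (hac : a ≠ c)
    (hbc : b ≠ c) {ω : Config E} (hbot : G.IsBot ω a b c) {e₀ : E} (hl : G.Link e₀ b c) :
    G.Conn (Function.update ω e₀ true) b c ∧ ¬ G.Conn (Function.update ω e₀ true) a b := by
  constructor
  · exact hl.conn (Function.update_self ..)
  · refine hbot.not_conn_ab_of_closed_side hG hs hab hac hbc fun e he he0 => ?_
    have hee : e = e₀ := by
      by_contra hee
      rw [Function.update_of_ne hee] at he
      exact Bool.noConfusion (he0.symm.trans he)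
    subst hee
    have hb : b ≠ a ∧ ¬ G.OpenTo ω b a :=
      ⟨hab.symm, hbot.not_openTo_marks (Or.inr (Or.inl rfl)) (Or.inl rfl) hab.symm⟩
    have hc : c ≠ a ∧ ¬ G.OpenTo ω c a :=
      ⟨hac.symm, hbot.not_openTo_marks (Or.inr (Or.inr rfl)) (Or.inl rfl) hac.symm⟩
    rcases hl with ⟨h1, h2⟩ | ⟨h1, h2⟩
    · rw [h1, h2]
      exact ⟨hb, hc⟩
    · rw [h1, h2]
      exact ⟨hc, hb⟩

/-- Closing the `bc`-edge again recovers a `bot` configuration. -/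
theorem update_bc_inv [DecidableEq E] (hbc : b ≠ c) {ω : Config E} (hbot : G.IsBot ω a b c) {e₀ : E}
    (hl : G.Link e₀ b c) : Function.update (Function.update ω e₀ true) e₀ false = ω := by
  rw [Function.update_idem]
  have h0 : ω e₀ = false := by
    cases he : ω e₀
    · rfl
    · exact absurd ⟨e₀, he, hl⟩
        (hbot.not_openTo_marks (Or.inr (Or.inl rfl)) (Or.inr (Or.inr rfl)) hbc)
  rw [← h0, Function.update_eq_self]

/-! #### Case 2 without a `bc`-edge: open the `c`- and `b`-edges of an isolated hub -/

variable (G)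

/-- The isolated hub chosen in Case 2. -/
noncomputable def case2Hub {ω : Config E} (h : G.Case2Iso ω a b c) : V := Classical.choose h

/-- Its edge to `c`. -/
noncomputable def case2EdgeC {ω : Config E} (h : G.Case2Iso ω a b c) : E :=
  Classical.choose (Classical.choose_spec h).2.2.1

/-- Its edge to `b`. -/
noncomputable def case2EdgeB {ω : Config E} (h : G.Case2Iso ω a b c) : E :=
  Classical.choose (Classical.choose_spec h).2.2.2

/-- **The Case-2 map without a `bc`-edge**: open the `c`- and `b`-edges of the chosen hub. -/
noncomputable def phi3 [DecidableEq E] (a b c : V) (ω : Config E) : Config E :=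
  if h : G.Case2Iso ω a b c then
    Function.update (Function.update ω (G.case2EdgeC h) true) (G.case2EdgeB h) true
  else ω

/-- **Its decoder**: close every open `b`- or `c`-edge of a hub with open edges to both. -/
noncomputable def closeBC [DecidableEq E] (a b c : V) (ω₃ : Config E) : Config E := fun f =>
  if ω₃ f = true ∧ ∃ h, IsHubV a b c h ∧ (G.Link f h b ∨ G.Link f h c) ∧
      G.OpenTo ω₃ h b ∧ G.OpenTo ω₃ h c then false else ω₃ f

variable {G}

/-- The chosen hub of Case 2 is an isolated hub with the chosen `c`- and `b`-edges. -/
theorem case2Hub_spec {ω : Config E} (h : G.Case2Iso ω a b c) :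
    IsHubV a b c (G.case2Hub h) ∧ G.NoOpen ω a b c (G.case2Hub h) ∧
      G.Link (G.case2EdgeC h) (G.case2Hub h) c ∧ G.Link (G.case2EdgeB h) (G.case2Hub h) b :=
  ⟨(Classical.choose_spec h).1, (Classical.choose_spec h).2.1,
    Classical.choose_spec (Classical.choose_spec h).2.2.1,
    Classical.choose_spec (Classical.choose_spec h).2.2.2⟩

/-- The two opened edges are distinct. -/
theorem case2EdgeC_ne (hbc : b ≠ c) {ω : Config E} (h : G.Case2Iso ω a b c) :
    G.case2EdgeC h ≠ G.case2EdgeB h := by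
  obtain ⟨hh, -, hlc, hlb⟩ := case2Hub_spec h
  intro heq
  rw [heq] at hlc
  rcases hlb.ends_eq hlc with ⟨-, h'⟩ | ⟨h', -⟩
  · exact hbc h'.symm
  · exact hh.2.1 h'

/-- The two opened edges are the only open `b`/`c`-edges of a hub with open edges to both. -/
theorem phi3_open_iff [DecidableEq E] (hbc : b ≠ c) {ω : Config E} (hbot : G.IsBot ω a b c)
    (h2 : G.Case2Iso ω a b c) (f : E) :
    (Function.update (Function.update ω (G.case2EdgeC h2) true) (G.case2EdgeB h2) true f = true ∧
      ∃ h, IsHubV a b c h ∧ (G.Link f h b ∨ G.Link f h c) ∧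
        G.OpenTo (Function.update (Function.update ω (G.case2EdgeC h2) true)
          (G.case2EdgeB h2) true) h b ∧
        G.OpenTo (Function.update (Function.update ω (G.case2EdgeC h2) true)
          (G.case2EdgeB h2) true) h c) ↔
      f = G.case2EdgeC h2 ∨ f = G.case2EdgeB h2 := by
  obtain ⟨hh, hno, hlc, hlb⟩ := case2Hub_spec h2
  have hne := G.case2EdgeC_ne hbc h2
  set r := G.case2Hub h2 with hr
  set ec := G.case2EdgeC h2 with hec
  set eb := G.case2EdgeB h2 with heb
  set ω₃ := Function.update (Function.update ω ec true) eb true with hω₃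
  have h3c : ω₃ ec = true := by
    rw [hω₃, Function.update_of_ne hne, Function.update_self]
  have h3b : ω₃ eb = true := Function.update_self ..
  have h3 : ∀ g, g ≠ ec → g ≠ eb → ω₃ g = ω g := fun g h1 h2 => by
    rw [hω₃, Function.update_of_ne h2, Function.update_of_ne h1]
  -- an open `ω`-edge at `r` contradicts `NoOpen`
  have hr_closed : ∀ g, ω g = true → (G.Link g r b ∨ G.Link g r c) → False := by
    rintro g hg (hl | hl)
    · exact hno.2.1 ⟨g, hg, hl⟩
    · exact hno.2.2 ⟨g, hg, hl⟩
  constructor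
  · rintro ⟨hf, h, hh', hlf, ⟨g₁, hg₁, hl₁⟩, ⟨g₂, hg₂, hl₂⟩⟩
    by_contra hfe
    push Not at hfe
    rw [h3 f hfe.1 hfe.2] at hf
    have hhr : h ≠ r := by
      rintro rfl
      exact hr_closed f hf hlf
    -- `g₁` (the open `b`-edge of `h`) is neither `ec` nor `eb`
    have hg₁' : g₁ ≠ ec ∧ g₁ ≠ eb := by
      constructor
      · rintro rfl
        rcases hlc.ends_eq hl₁ with ⟨-, h'⟩ | ⟨h', -⟩
        · exact hbc h'
        · exact hh'.2.2 h'
      · rintro rfl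
        rcases hlb.ends_eq hl₁ with ⟨h', -⟩ | ⟨h', -⟩
        · exact hhr h'
        · exact hh'.2.1 h'
    have hg₂' : g₂ ≠ ec ∧ g₂ ≠ eb := by
      constructor
      · rintro rfl
        rcases hlc.ends_eq hl₂ with ⟨h', -⟩ | ⟨h', -⟩
        · exact hhr h'
        · exact hh'.2.2 h'
      · rintro rfl
        rcases hlb.ends_eq hl₂ with ⟨-, h'⟩ | ⟨h', -⟩
        · exact hbc h'.symm
        · exact hh'.2.1 h'
    rw [h3 g₁ hg₁'.1 hg₁'.2] at hg₁
    rw [h3 g₂ hg₂'.1 hg₂'.2] at hg₂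
    exact hbot.openTo_unique (Or.inr (Or.inl rfl)) (Or.inr (Or.inr rfl)) hbc ⟨g₁, hg₁, hl₁⟩
      ⟨g₂, hg₂, hl₂⟩
  · rintro (rfl | rfl)
    · exact ⟨h3c, r, hh, Or.inr hlc, ⟨eb, h3b, hlb⟩, ⟨ec, h3c, hlc⟩⟩
    · exact ⟨h3b, r, hh, Or.inl hlb, ⟨eb, h3b, hlb⟩, ⟨ec, h3c, hlc⟩⟩

/-- The decoder inverts the Case-2 map on `bot ∩ Case2Iso`. -/
theorem closeBC_phi3 [DecidableEq E] (hbc : b ≠ c) {ω : Config E} (hbot : G.IsBot ω a b c)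
    (h2 : G.Case2Iso ω a b c) : G.closeBC a b c (G.phi3 a b c ω) = ω := by
  obtain ⟨-, hno, hlc, hlb⟩ := case2Hub_spec h2
  have h0c : ω (G.case2EdgeC h2) = false := by
    cases he : ω (G.case2EdgeC h2)
    · rfl
    · exact absurd ⟨_, he, hlc⟩ hno.2.2
  have h0b : ω (G.case2EdgeB h2) = false := by
    cases he : ω (G.case2EdgeB h2)
    · rfl
    · exact absurd ⟨_, he, hlb⟩ hno.2.1
  have hne := G.case2EdgeC_ne hbc h2
  funext f
  unfold phi3
  rw [dif_pos h2]
  unfold closeBC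
  by_cases hf : f = G.case2EdgeC h2 ∨ f = G.case2EdgeB h2
  · rw [if_pos ((G.phi3_open_iff hbc hbot h2 f).2 hf)]
    rcases hf with rfl | rfl
    · exact h0c.symm
    · exact h0b.symm
  · push Not at hf
    rw [if_neg (fun h => absurd ((G.phi3_open_iff hbc hbot h2 f).1 h) (by
      push Not; exact hf)), Function.update_of_ne hf.2, Function.update_of_ne hf.1]

/-- The Case-2 image (no `bc`-edge) lies in `bc|a`. -/
theorem phi3_mem [DecidableEq E] (hG : G.IsHubGraph a b c) (hs : G.IsSimple) (hab : a ≠ b) (hac : a ≠ c)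
    (hbc : b ≠ c) {ω : Config E} (hbot : G.IsBot ω a b c) (h2 : G.Case2Iso ω a b c) :
    G.Conn (G.phi3 a b c ω) b c ∧ ¬ G.Conn (G.phi3 a b c ω) a b := by
  obtain ⟨hh, hno, hlc, hlb⟩ := case2Hub_spec h2
  have hne := G.case2EdgeC_ne hbc h2
  unfold phi3
  rw [dif_pos h2]
  constructor
  · have h1 : G.Conn (Function.update (Function.update ω (G.case2EdgeC h2) true)
        (G.case2EdgeB h2) true) (G.case2Hub h2) b := hlb.conn (Function.update_self ..)
    have h2' : G.Conn (Function.update (Function.update ω (G.case2EdgeC h2) true)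
        (G.case2EdgeB h2) true) (G.case2Hub h2) c :=
      hlc.conn (by rw [Function.update_of_ne hne, Function.update_self])
    exact h1.symm.trans h2'
  · refine hbot.not_conn_ab_of_closed_side hG hs hab hac hbc fun e he he0 => ?_
    have hr : G.case2Hub h2 ≠ a ∧ ¬ G.OpenTo ω (G.case2Hub h2) a := ⟨hh.1, hno.1⟩
    have hb : b ≠ a ∧ ¬ G.OpenTo ω b a :=
      ⟨hab.symm, hbot.not_openTo_marks (Or.inr (Or.inl rfl)) (Or.inl rfl) hab.symm⟩
    have hc : c ≠ a ∧ ¬ G.OpenTo ω c a :=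
      ⟨hac.symm, hbot.not_openTo_marks (Or.inr (Or.inr rfl)) (Or.inl rfl) hac.symm⟩
    by_cases hee : e = G.case2EdgeB h2
    · subst hee
      rcases hlb with ⟨h1, h2⟩ | ⟨h1, h2⟩
      · rw [h1, h2]
        exact ⟨hr, hb⟩
      · rw [h1, h2]
        exact ⟨hb, hr⟩
    by_cases hee' : e = G.case2EdgeC h2
    · subst hee'
      rcases hlc with ⟨h1, h2⟩ | ⟨h1, h2⟩
      · rw [h1, h2]
        exact ⟨hr, hc⟩
      · rw [h1, h2]
        exact ⟨hc, hr⟩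
    · rw [Function.update_of_ne hee, Function.update_of_ne hee'] at he
      exact Bool.noConfusion (he0.symm.trans he)

end Injection

end MultiGraph

end PercRepro
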